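import Summits.BirchSwinnertonDyer.BirchSwinnertonDyer.Theorems.ErratumRoadFiveNonSurjCornerLocalSplit
import Literature.NumberTheory.EllipticCurves.TateCurve.InertiaTorsionOfTateParameterPower
import Literature.NumberTheory.EllipticCurves.TateCurve.RankOneTorsionSubgroups
import Literature.NumberTheory.EllipticCurves.TateCurve.NumberFieldUniformizationTateJ
import HarnessLib

/-!
# Route `ErratumRoadFive` (rung K2), crux `NonSurjCorner` (item stmt-BirchSwinnertonDyer-19065):
# AT EVERY CORNER PAIR THE TATE PARAMETER AT `p` IS A `p`-TH POWER IN `ℚ_p` — the Kummer class of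
# `q` vanishes, `E[p]|_{Γ_{ℚ_p}}` is split, `E_q(ℚ_p)` has a point of order `p`, and a SPLIT
# multiplicative corner curve has a `ℚ_p`-rational point of order `p`
# (cell `bsd-stepL`, seat `bsd-stepL-corner5-p2` g3, WIDTH-LEVER lane B «class-level road»;
# `--supports stmt-BirchSwinnertonDyer-19065 --as helper`)

WHY THIS FILE. `ErratumRoadFiveNonSurjCornerLocalSplit.lean` (this seat) gives, at `p ≠ 2`
multiplicative with `p ∤ #ρ̄_{E,p}(Γ_ℚ)` (so on the whole non-surjective corner), two cyclic subgroups
`L₀, L₁ ≤ E[p](ℚ̄)` of order `p`, `L₀ ⊓ L₁ = 0`, each stable under every `σ ∈ Γ_{ℚ_p}` (through the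
restriction `res_ι` along `ι : ℚ̄ → ℚ̄_p`). Transport them to the Tate curve: over `ℚ̄_p` the curve
is `E_q` (Silverman *ATAEC* V.5.3 (a), the tree's `isomorphic_tateCurve_of_one_lt_norm_j_holds`) with
TWISTED equivariance `σ(C P) = χ(σ) C(σ P)`, `χ = ±1` (Lemma V.5.2 (c), the tree's
`smul_eq_sign_smul`); a sign does not move a subgroup, so `E_q(ℚ̄_p)` acquires TWO distinct
`Γ_{ℚ_p}`-stable subgroups of order `p`. By [GenEll] Lemma 3.2 (i) — the tree's `GenEll_lemma32_i`
(`TateCurve/RankOneTorsionSubgroups`): a stable rank-one subgroup of `E_q[p]` is `μ_p` UNLESS `q` is a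
`p`-th power in the base field — this forces **`q ∈ (ℚ_p^×)^p`** (`exists_pow_eq_tateParameter_of_mult
_of_not_dvd_card`, `NonSurjCorner.exists_pow_eq_tateParameter`). This is the lineage's «paper only»
row (memo CORNER5-P2-G2 §1: «the Tate parameter is a `p`-th power in `ℚ_p`, i.e. `u_q^{p−1} ≡ 1
(mod p²)`, `E[p]|_{G_{ℚ_p}}` SPLIT») as a kernel theorem, and sharper than the crux binder
`p ∣ ord_p Δ_min = ord_p q` (the valuation of a `p`-th power). Consequences here:

* `exists_rational_torsion_tateCurve_of_pow_eq` (pure Tate curve, any complete ultrametric `K` of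
  characteristic `0`): `q = r^l` in `K` ⇒ `E_q(K̄)` has a NON-ZERO `Γ_K`-FIXED point killed by the
  prime `l` (Tate's `φ(r)`; `r ∉ q^ℤ` by norms).
* `exists_fixed_torsion_of_split_of_not_dvd_card` / `NonSurjCorner.exists_fixed_torsion_of_split`:
  at a corner pair which is SPLIT multiplicative at `p` (`a_p = +1`; 6 of the 15 Cartan pairs of
  record, memo §1b), some non-zero `x ∈ E[p](ℚ̄)` is fixed by the whole local Galois group `Γ_{ℚ_p}`
  — `E(ℚ_p)` has a point of order `p` (V.5.3 (b), the tree's `exists_tateParameter_of_hasSplit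
  MultiplicativeReductionAt` + the equivariant `localPointsEquivTate`).

HONEST FRAMING: structure theorems about the local curve `E/ℚ_p` at a corner pair; nothing here
proves the crux, a registered stub (`stub_corner5`, `stub_corner7`) or BSD for any class; no census
number moves. Not proved here: the converse «non-split ⇒ `E(ℚ_p)[p] = 0`», and `δ₁ = χ_γ`.

References: [SilvermanATAEC1994] V.3.1 (c),(d), V.5.1–V.5.4 (PDF pp. 394–410), Ex. 5.13;
[MochizukiGenEll2010] §3 Lemma 3.2 (i); [Serre1972] §1.12; tree files `TateCurve/{Uniformization,
UniformizationHolds, RankOneTorsionSubgroups, NumberFieldUniformization{,Twisted,TateJ},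
InertiaTorsionOfTateParameterPower}`, `Theorems/ErratumRoadFiveNonSurjCornerLocalSplit`.
-/

set_option linter.dupNamespace false -- `Summit.BirchSwinnertonDyer.BirchSwinnertonDyer` (summit = problem), tree-wide
set_option autoImplicit false

noncomputable section

open scoped Classical NumberField
open IsDedekindDomain Field WeierstrassCurve

/-! ### §1. Tate curve: an `l`-th root of `q` in `K` gives a `K`-rational point of order `l` -/

namespace Literature.NumberTheory.EllipticCurves.TateCurve

open SteinWuthrich2013

universe u

/-- **A `p`-th root of the Tate parameter is a rational `p`-torsion point.** For the Tate curve
`E_q` over a complete ultrametric field `K` of characteristic `0` (`0 < ‖q‖ < 1`), a prime `l` and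
`r ∈ K` with `r^l = q`: `E_q(K̄)` has a point `z ≠ O` with `l z = O` fixed by EVERY `σ ∈ Γ_K` —
namely `z = φ(r)` for Tate's uniformisation `φ : K̄^× → E_q(K̄)` (surjective, kernel `q^ℤ`,
`Γ_K`-equivariant: Silverman *ATAEC* V.3.1 (c),(d), the tree's theorem `uniformization_holds`);
`z ≠ O` because `r ∈ q^ℤ` would give `‖q‖ = ‖q‖^{nl}` with `0 < ‖q‖ < 1`.
[cite: SilvermanATAEC1994, Thm. V.3.1 (c),(d) (PDF pp. 394–395)] [cite: MochizukiGenEll2010, §3 p. 15] -/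
theorem exists_rational_torsion_tateCurve_of_pow_eq {K : Type u} [NontriviallyNormedField K]
    [CompleteSpace K] [IsUltrametricDist K] [CharZero K] {q : K} (hq0 : q ≠ 0) (hq : ‖q‖ < 1)
    {l : ℕ} (hl : l.Prime) {r : K} (hr : r ^ l = q) :
    ∃ z : geomPoints (tateCurve q), z ≠ 0 ∧ l • z = 0 ∧ ∀ σ : absoluteGaloisGroup K, σ • z = z := by
  obtain ⟨φ, -, hker, hequiv, -⟩ := uniformization_holds q hq0 hq
  letI : NontriviallyNormedField (AlgebraicClosure K) :=
    spectralNorm.nontriviallyNormedField K (AlgebraicClosure K)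
  have hnK : ∀ k : K, ‖algebraMap K (AlgebraicClosure K) k‖ = ‖k‖ := fun k ↦ spectralNorm_extends k
  have hr0 : r ≠ 0 := by
    rintro rfl
    rw [zero_pow hl.ne_zero] at hr
    exact hq0 hr.symm
  set R : AlgebraicClosure K := algebraMap K (AlgebraicClosure K) r with hRdef
  have hR0 : R ≠ 0 := (map_ne_zero _).mpr hr0
  set u : (AlgebraicClosure K)ˣ := Units.mk0 R hR0 with hu
  refine ⟨φ (Additive.ofMul u), ?_, ?_, ?_⟩
  · -- `φ(r) ≠ O`: else `r = q^n`, and norms give `‖q‖ = ‖q‖^(n l)`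
    intro h0
    obtain ⟨n, hn⟩ := (hker u).mp h0
    have hnR : ‖R‖ = ‖q‖ ^ n := by
      rw [show (R : AlgebraicClosure K) = (u : AlgebraicClosure K) from rfl, hn, norm_zpow, hnK]
    have hnr : ‖r‖ = ‖q‖ ^ n := by rw [← hnR, hRdef, hnK]
    have hql : ‖q‖ = ‖q‖ ^ (n * l) := by
      conv_lhs => rw [← hr, norm_pow, hnr, ← zpow_natCast, ← zpow_mul]
    have hq1 : ‖q‖ ≠ 1 := hq.ne
    have hqpos : 0 < ‖q‖ := norm_pos_iff.mpr hq0
    have hinj := zpow_right_injective₀ hqpos hq1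
    have h1 : (1 : ℤ) = n * l := hinj (by simpa only [zpow_one] using hql)
    have hl1 : (l : ℤ) ∣ 1 := ⟨n, by rw [h1, mul_comm]⟩
    have : l = 1 := by exact_mod_cast Int.eq_one_of_dvd_one (Int.natCast_nonneg l) hl1
    exact hl.one_lt.ne' this
  · -- `l • φ(r) = φ(r^l) = φ(q) = O`
    rw [← map_nsmul, ← ofMul_pow, hker]
    refine ⟨1, ?_⟩
    rw [zpow_one, Units.val_pow_eq_pow_val, show (u : AlgebraicClosure K) = R from rfl, hRdef,
      ← map_pow, hr]
  · -- `σ • φ(r) = φ(σ r) = φ(r)`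
    intro σ
    rw [hequiv]
    congr 2
    ext
    rw [Units.coe_map, MonoidHom.coe_coe, show (u : AlgebraicClosure K) = R from rfl, hRdef]
    exact AlgEquiv.commutes _ r

end Literature.NumberTheory.EllipticCurves.TateCurve

/-! ### §2. The Tate parameter of a corner pair is a `p`-th power in `ℚ_p` -/

namespace Summit.BirchSwinnertonDyer.BirchSwinnertonDyer.Theorems.CornerLocal

open WeierstrassCurve NumberField Rat.HeightOneSpectrum
  Literature.NumberTheory.EllipticCurves Literature.NumberTheory.EllipticCurves.TateCurve
  Literature.NumberTheory.GaloisRepresentations SteinWuthrich2013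
  Literature.NumberTheory.EllipticCurves.Rank1Residual
  Summit.BirchSwinnertonDyer.Rank1Residual

variable (W : WeierstrassCurve ℚ) [W.IsElliptic] (p : ℕ) [hp : Fact p.Prime]

set_option maxHeartbeats 1600000 in
/-- **V.5.3 (a) + V.5.2 (c) packaged: the sign-equivariant isomorphism `E(K̄_v) ≃ E_q(K̄_v)`.** For an
elliptic curve `W` over a number field `K` with multiplicative reduction at `v` and Tate parameter
`q ∈ K_v` (`q ≠ 0`, `‖q‖ < 1`, `j(E_q) = j(W)`): there are a square root `t ∈ K̄_v` of
`γ(W) = −c₄/c₆` and an additive isomorphism `e : E(K̄_v) ≃+ E_q(K̄_v)` with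
`σ • e(P) = χ(σ) • e(σ • P)`, `χ(σ) = 1` if `σ t = t` and `−1` otherwise (Silverman *ATAEC* V.5.3 (a):
`W ⊗ K̄_v ≅ E_{q'} ⊗ K̄_v`, `q' = q` by Lemma V.5.1; Lemma V.5.2 (c): the tree's `smul_eq_sign_smul`).
[cite: SilvermanATAEC1994, Lemma V.5.1, Lemma V.5.2 (c), Thm. V.5.3 (a) (PDF pp. 405–409)] -/
theorem exists_signEquiv_tateCurve {K : Type} [Field K] [NumberField K] (W : WeierstrassCurve K)
    [W.IsElliptic] {v : HeightOneSpectrum (𝓞 K)} (hmult : W.HasMultiplicativeReductionAt v)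
    {q : v.adicCompletion K} (hq0 : q ≠ 0) (hq : ‖q‖ < 1)
    (hqj : tateJ q = (W.baseChange (v.adicCompletion K)).j) :
    ∃ (t : AlgebraicClosure (v.adicCompletion K))
      (e : localPoints W (v.adicCompletion K) ≃+ geomPoints (tateCurve q)),
      ∀ (σ : absoluteGaloisGroup (v.adicCompletion K)) (P : localPoints W (v.adicCompletion K)),
        σ • e P =
          (if absoluteGaloisGroup.toAlgEquiv _ σ t = t then (1 : ℤ) else -1) • e (σ • P) := by
  letI := Literature.NumberTheory.GaloisRepresentations.Ultrametric.AdicCompletion.nontriviallyNormedField K v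
  haveI := charZero_adicCompletion' K v
  have hj := one_lt_norm_j_baseChange_of_hasMultiplicativeReductionAt W v hmult
  obtain ⟨hc₄, hc₆⟩ := c₄_ne_zero_and_c₆_ne_zero_of_hasMultiplicativeReductionAt W v hmult
  obtain ⟨q', hq0', hq', hqj', C, hC⟩ :=
    isomorphic_tateCurve_of_one_lt_norm_j_holds (W.baseChange (v.adicCompletion K)) hj
  have hqq : q' = q := tateParameter_unique hq0' hq' hqj' hq0 hq hqj
  subst hqq
  obtain ⟨hEc₄, hEc₆⟩ := tateCurve_c₄_ne_zero_and_c₆_ne_zero W v hq0' hq' hqj' hj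
  obtain ⟨t, ht⟩ := IsAlgClosed.exists_pow_nat_eq
    (algebraMap (v.adicCompletion K) (AlgebraicClosure (v.adicCompletion K))
      (algebraMap K (v.adicCompletion K) (-(W.c₄ / W.c₆)))) two_pos
  obtain ⟨e, he⟩ : ∃ e : localPoints W (v.adicCompletion K) ≃+ geomPoints (tateCurve q'),
      ∀ P, e P = Affine.Point.congrEquiv hC (VariableChange.pointEquiv _ C
        (Affine.Point.congrEquiv (W.baseChange_baseChange_adicCompletion v).symm P)) :=
    ⟨(Affine.Point.congrEquiv (W.baseChange_baseChange_adicCompletion v).symm).trans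
      ((VariableChange.pointEquiv ((W.baseChange (v.adicCompletion K)).baseChange
        (AlgebraicClosure (v.adicCompletion K))) C).trans (Affine.Point.congrEquiv hC)),
      fun _ ↦ rfl⟩
  exact ⟨t, e, smul_eq_sign_smul W v hc₄ hc₆ hq' hEc₄ hEc₆ C hC ht e he⟩

/-- `Mult W p` read at the place `v` of `𝓞 ℚ` above `p`. [folklore] -/
theorem hasMultiplicativeReductionAt_of_mult (hmult : Mult W p)
    {v : HeightOneSpectrum (𝓞 ℚ)} (hv : (primesEquiv v : ℕ) = p) :
    W.HasMultiplicativeReductionAt v := by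
  have hmult' : haveI := Fact.mk (primesEquiv v).2
      W.HasMultiplicativeReductionAtPrime (primesEquiv v) := by
    have key : ∀ (q : ℕ) (hq : Fact q.Prime), q = p →
        @WeierstrassCurve.HasMultiplicativeReductionAtPrime W q hq := by
      rintro q hq rfl; exact hmult
    exact key _ _ hv
  exact (W.hasMultiplicativeReductionAtPrime_iff_hasMultiplicativeReductionAt_ringOfIntegers v).mp hmult'

/-- The place form read back: `W.HasMultiplicativeReductionAt v` at the place of `p` gives `Mult W p`.
[folklore] -/
theorem mult_of_hasMultiplicativeReductionAt {v : HeightOneSpectrum (𝓞 ℚ)}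
    (hv : (primesEquiv v : ℕ) = p) (hmult : W.HasMultiplicativeReductionAt v) : Mult W p := by
  have hmult' := (W.hasMultiplicativeReductionAtPrime_iff_hasMultiplicativeReductionAt_ringOfIntegers
    v).mpr hmult
  have key : ∀ (q : ℕ) (hq : Fact q.Prime), q = p →
      @WeierstrassCurve.HasMultiplicativeReductionAtPrime W q hq → Mult W p := by
    rintro q hq rfl h
    convert h
  exact key _ _ hv hmult'

/-- **THE TATE PARAMETER OF A CORNER PAIR IS A `p`-TH POWER IN `ℚ_p`.** Let `W/ℚ` be elliptic,
`p ≠ 2` multiplicative with `p ∤ #ρ̄_{E,p}(Γ_ℚ)` (e.g. `E[p]` irreducible and `ρ̄_{E,p}` not onto),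
`v` the place of `p` and `q ∈ ℚ_v` the Tate parameter (`q ≠ 0`, `‖q‖ < 1`, `j(E_q) = j(W)`). Then
`q = r^p` for some `r ∈ ℚ_v`. Proof: the two `Γ_{ℚ_p}`-stable lines `L₀, L₁` of `E[p](ℚ̄)`
(`exists_stable_lines_local_of_mult_of_not_dvd_card`) are carried by `ι_*` and the `ℚ̄_p`-isomorphism
`C : W ⥲ E_q` (V.5.3 (a)), whose equivariance is twisted by a SIGN (V.5.2 (c), `smul_eq_sign_smul`),
to two distinct `Γ_{ℚ_p}`-stable subgroups of order `p` of `E_q(ℚ̄_p)`; [GenEll] Lemma 3.2 (i)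
(`GenEll_lemma32_i`) leaves only `q ∈ (ℚ_p^×)^p`. Equivalently: the Kummer class of `q` in
`H¹(ℚ_p, μ_p)` vanishes, `0 → μ_p → E_q[p] → ℤ/p → 0` SPLITS, `u_q^{p-1} ≡ 1 (mod p²)` for the unit
part `u_q` of `q`, and `p ∣ ord_p q = ord_p Δ_min`.
[cite: SilvermanATAEC1994, Lemma V.5.2 (c), Thm. V.5.3 (PDF pp. 406–409)]
[cite: MochizukiGenEll2010, §3 Lemma 3.2 (i)] [cite: Serre1972, §1.12] -/
theorem exists_pow_eq_tateParameter_of_mult_of_not_dvd_card (hp2 : p ≠ 2) (hmult : Mult W p)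
    (hG : ¬ p ∣ Nat.card (galoisRepTorsion W p).range)
    {v : HeightOneSpectrum (𝓞 ℚ)} (hv : (primesEquiv v : ℕ) = p)
    {q : v.adicCompletion ℚ} (hq0 : q ≠ 0) (hq : ‖q‖ < 1)
    (hqj : tateJ q = (W.baseChange (v.adicCompletion ℚ)).j) :
    ∃ r : v.adicCompletion ℚ, r ^ p = q := by
  have hpp : p.Prime := hp.out
  -- NB: no `CharZero ℚ_v` instance in scope — it would let `DivisionRing.toRatAlgebra` compete with
  -- `instAlgebraAdicCompletion` for `Algebra ℚ ℚ_v`; it is passed explicitly where needed.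
  letI := Literature.NumberTheory.GaloisRepresentations.Ultrametric.AdicCompletion.nontriviallyNormedField ℚ v
  have hmultv : W.HasMultiplicativeReductionAt v := hasMultiplicativeReductionAt_of_mult W p hmult hv
  -- V.5.3 (a) + V.5.2 (c): the sign-equivariant `e : W(ℚ̄_v) ≃+ E_q(ℚ̄_v)`
  obtain ⟨t, e, hsign⟩ := exists_signEquiv_tateCurve W hmultv hq0 hq hqj
  -- the two `Γ_{ℚ_p}`-stable lines of `E[p](ℚ̄)` along the chosen embedding `ι`
  obtain ⟨𝔐, h𝔐⟩ := v.localPrimesAbove_nonempty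
  set ι := closureEmb (K := ℚ) (v.adicCompletion ℚ) with hι
  obtain ⟨L₀, L₁, h₀, h₁, hinf, hstab, -⟩ :=
    exists_stable_lines_local_of_mult_of_not_dvd_card W p hp2 hmult hG hv ι h𝔐
  -- the transport `f = e ∘ ι_* : E[p](ℚ̄) → E_q(ℚ̄_p)`, injective, sign-equivariant
  set f : geomTorsion W p →+ geomPoints (tateCurve q) :=
    e.toAddMonoidHom.comp ((pointsMapOfEmb W ι).comp (geomTorsion W (p : ℤ)).subtype) with hf
  have hfapply : ∀ x : geomTorsion W p, f x = e (pointsMapOfEmb W ι (x : geomPoints W)) := fun _ ↦ rfl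
  have hfinj : Function.Injective f := by
    intro x y hxy
    rw [hfapply, hfapply] at hxy
    exact Subtype.ext (pointsMapOfEmb_injective W ι (e.injective hxy))
  have hfsmul : ∀ (σ : absoluteGaloisGroup (v.adicCompletion ℚ)) (x : geomTorsion W p),
      σ • f x = (if absoluteGaloisGroup.toAlgEquiv _ σ t = t then (1 : ℤ) else -1) •
        f (resGalOfEmb ι σ • x) := by
    intro σ x
    rw [hfapply, hfapply, hsign σ, AddSubgroup.torsionBy.coe_smul, pointsMapOfEmb_smul]
  have hN : ∀ L : AddSubgroup (geomTorsion W p),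
      (∀ σ : absoluteGaloisGroup (v.adicCompletion ℚ), ∀ x ∈ L, resGalOfEmb ι σ • x ∈ L) →
      ∀ σ : absoluteGaloisGroup (v.adicCompletion ℚ), ∀ z ∈ L.map f, σ • z ∈ L.map f := by
    intro L hL σ z hz
    obtain ⟨x, hx, rfl⟩ := AddSubgroup.mem_map.mp hz
    rw [hfsmul]
    exact AddSubgroup.zsmul_mem _ (AddSubgroup.mem_map_of_mem f (hL σ x hx)) _
  have hN₀ : Nat.card (L₀.map f) = p := by rw [AddSubgroup.card_map_of_injective hfinj, h₀]
  have hN₁ : Nat.card (L₁.map f) = p := by rw [AddSubgroup.card_map_of_injective hfinj, h₁]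
  -- [GenEll] Lemma 3.2 (i): either `q` is a `p`-th power, or the stable line is unique
  rcases @GenEll_lemma32_i (v.adicCompletion ℚ) _ _ _ (charZero_adicCompletion' ℚ v) q hq0 hq p hpp
      (L₀.map f) hN₀ (hN L₀ fun σ ↦ (hstab σ).1) with h | h
  · exact h
  · exfalso
    have hEq : L₁.map f = L₀.map f := h _ hN₁ (hN L₁ fun σ ↦ (hstab σ).2)
    have hL : L₁ = L₀ := AddSubgroup.map_injective hfinj hEq
    rw [hL, inf_idem] at hinf
    rw [hinf, AddSubgroup.card_bot] at h₀
    exact hpp.one_lt.ne' h₀.symm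

/-- **AT EVERY CORNER PAIR THE TATE PARAMETER AT `p` IS A `p`-TH POWER IN `ℚ_p`** (crux
`NonSurjCorner`, both stubs, every `5S4` / `5Ns` / `N_s(7)` pair, any odd `p`): for `(E, p)` in class
X11b with `ρ̄_{E,p}` NOT onto, `v` the place of `p` and `q ∈ ℚ_v` the Tate parameter of `E/ℚ_v`,
`q = r^p` with `r ∈ ℚ_v` — the extension `0 → μ_p → E_q[p] → ℤ/p → 0` splits over `ℚ_p`. The crux
binders `p ∈ {5,7}`, `p ∣ ord_p Δ_min`, `¬ Ram` are not used (`p ∤ #G` by Serre Prop. 15).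
Nothing about BSD is claimed. [cite: SilvermanATAEC1994, Lemma V.5.2 (c), Thm. V.5.3 (PDF pp. 406–409)]
[cite: MochizukiGenEll2010, §3 Lemma 3.2 (i)] [cite: Serre1972, §1.12, §2.4 Prop. 15] -/
theorem NonSurjCorner.exists_pow_eq_tateParameter [W.IsGloballyMinimal] (hX : ClassX11b W p)
    (hns : ¬ Surj W p) {v : HeightOneSpectrum (𝓞 ℚ)} (hv : (primesEquiv v : ℕ) = p)
    {q : v.adicCompletion ℚ} (hq0 : q ≠ 0) (hq : ‖q‖ < 1)
    (hqj : tateJ q = (W.baseChange (v.adicCompletion ℚ)).j) :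
    ∃ r : v.adicCompletion ℚ, r ^ p = q := by
  obtain ⟨-, hp2, hmult, hirr⟩ := hX
  obtain ⟨e, Φ, he, -⟩ := exists_frame_galoisRepTorsion_rat W p
  have hG : ¬ p ∣ Nat.card (galoisRepTorsion W p).range := by
    rw [← card_map_range_galoisRepTorsion W p Φ]
    exact not_dvd_card_of_not_hasSurjectiveModNGaloisRep W p Φ e he hirr hns
  exact exists_pow_eq_tateParameter_of_mult_of_not_dvd_card W p hp2 hmult hG hv hq0 hq hqj

/-! ### §3. Split multiplicative corner pairs: a `ℚ_p`-rational point of order `p` -/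

/-- **A SPLIT multiplicative pair with `p ∤ #ρ̄(Γ_ℚ)` has a `ℚ_p`-rational point of order `p`.**
`W/ℚ` elliptic, `p ≠ 2`, `v` the place of `p`, `W` SPLIT multiplicative at `v`, `p ∤ #ρ̄_{E,p}(Γ_ℚ)`,
`ι : ℚ̄ → ℚ̄_p` a `ℚ`-embedding: some `x ∈ E[p](ℚ̄)`, `x ≠ O`, is fixed by `res_ι σ` for EVERY
`σ ∈ Γ_{ℚ_p}` (the image `ι_* x ∈ E(ℚ̄_p)` is a `Γ_{ℚ_p}`-fixed point of order `p`). Proof: over `ℚ_v`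
itself `W ≅ E_q` (V.5.3 (b), `exists_tateParameter_of_hasSplitMultiplicativeReductionAt`, equivariant
`localPointsEquivTate`), `q = r^p` (§2), Tate's `φ(r)` is a rational point of order `p` (§1), and
`p`-torsion of `E(ℚ̄_p)` comes from `E(ℚ̄)` (`exists_pointsMapOfEmb_eq_of_nsmul_eq_zero`).
[cite: SilvermanATAEC1994, Thm. V.3.1 (c),(d), Thm. V.5.3 (PDF pp. 394–409)]
[cite: MochizukiGenEll2010, §3 Lemma 3.2 (i)] -/
theorem exists_fixed_torsion_of_split_of_not_dvd_card (hp2 : p ≠ 2)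
    {v : HeightOneSpectrum (𝓞 ℚ)} (hv : (primesEquiv v : ℕ) = p)
    (hsplit : W.HasSplitMultiplicativeReductionAt v)
    (hG : ¬ p ∣ Nat.card (galoisRepTorsion W p).range)
    (ι : AlgebraicClosure ℚ →ₐ[ℚ] AlgebraicClosure (v.adicCompletion ℚ)) :
    ∃ x : geomTorsion W p, x ≠ 0 ∧
      ∀ σ : absoluteGaloisGroup (v.adicCompletion ℚ), resGalOfEmb ι σ • x = x := by
  have hpp : p.Prime := hp.out
  letI := Literature.NumberTheory.GaloisRepresentations.Ultrametric.AdicCompletion.nontriviallyNormedField ℚ v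
  have hmult : Mult W p := mult_of_hasMultiplicativeReductionAt W p hv hsplit.hasMultiplicativeReductionAt
  -- V.5.3 (b): `W ⊗ ℚ_v ≅ E_q` over `ℚ_v`, equivariantly on `ℚ̄_v`-points
  obtain ⟨q, hq0, hq, hqj, -, C, hC⟩ :=
    exists_tateParameter_of_hasSplitMultiplicativeReductionAt ℚ v W hsplit
  have hj' : (W.baseChange (v.adicCompletion ℚ)).j = algebraMap ℚ (v.adicCompletion ℚ) W.j :=
    W.map_j _
  have hqj' : tateJ q = (W.baseChange (v.adicCompletion ℚ)).j := by rw [hqj, hj']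
  -- `q = r^p` (§2) and Tate's rational `p`-torsion point `z = φ(r)` (§1)
  obtain ⟨r, hr⟩ := exists_pow_eq_tateParameter_of_mult_of_not_dvd_card W p hp2 hmult hG hv hq0 hq hqj'
  obtain ⟨z, hz0, hzp, hzfix⟩ := @exists_rational_torsion_tateCurve_of_pow_eq (v.adicCompletion ℚ) _ _ _
    (charZero_adicCompletion' ℚ v) q hq0 hq p hpp r hr
  set e := localPointsEquivTate W v C hC with he
  -- pull back to `W(ℚ̄_v)`: `y = e⁻¹ z` is `Γ_{ℚ_v}`-fixed of order `p`
  set y : localPoints W (v.adicCompletion ℚ) := e.symm z with hy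
  have hyfix : ∀ σ : absoluteGaloisGroup (v.adicCompletion ℚ), σ • y = y := by
    intro σ
    apply e.injective
    rw [localPointsEquivTate_smul, hy, AddEquiv.apply_symm_apply, hzfix]
  have hyp : p • y = 0 := by
    apply e.injective
    rw [map_nsmul, hy, AddEquiv.apply_symm_apply, hzp, map_zero]
  have hy0 : y ≠ 0 := by
    intro h
    apply hz0
    rw [← e.apply_symm_apply z, ← hy, h, map_zero]
  -- `p`-torsion of `W(ℚ̄_v)` comes from `E[p](ℚ̄)` along `ι`
  obtain ⟨P, hP, hPy⟩ := exists_pointsMapOfEmb_eq_of_nsmul_eq_zero W ι hpp.ne_zero hyp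
  refine ⟨⟨P, (Submodule.mem_torsionBy_iff (p : ℤ) P).mpr (by rw [natCast_zsmul, hP])⟩, ?_, ?_⟩
  · intro h
    apply hy0
    rw [← hPy, show P = 0 from congrArg Subtype.val h, map_zero]
  · intro σ
    apply Subtype.ext
    rw [AddSubgroup.torsionBy.coe_smul]
    apply pointsMapOfEmb_injective W ι
    rw [pointsMapOfEmb_smul, hPy, hyfix]

/-- **A SPLIT MULTIPLICATIVE CORNER PAIR HAS A `ℚ_p`-RATIONAL POINT OF ORDER `p`** (crux
`NonSurjCorner`; the `a_p = +1` sub-corner — 5 of the 12 `5Ns` pairs and `t17o7` among the pairs of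
record, memo CORNER5-P2-G2 §1b): for `(E, p)` in class X11b with `ρ̄_{E,p}` NOT onto and `E` split
multiplicative at the place `v` of `p`, some non-zero `x ∈ E[p](ℚ̄)` is fixed by `res_ι σ` for every
`σ ∈ Γ_{ℚ_p}`: `E(ℚ_p) ⊇ ℤ/p`. (Consistent with `p ∣ c_p = ord_p Δ_min` there; the anomalous local
type `{1, ω}` of CGLS 2022.) Nothing about BSD is claimed.
[cite: SilvermanATAEC1994, Thm. V.3.1 (c),(d), Thm. V.5.3 (PDF pp. 394–409)]
[cite: MochizukiGenEll2010, §3 Lemma 3.2 (i)] [cite: Serre1972, §1.12, §2.4 Prop. 15] -/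
theorem NonSurjCorner.exists_fixed_torsion_of_split [W.IsGloballyMinimal] (hX : ClassX11b W p)
    (hns : ¬ Surj W p) {v : HeightOneSpectrum (𝓞 ℚ)} (hv : (primesEquiv v : ℕ) = p)
    (hsplit : W.HasSplitMultiplicativeReductionAt v)
    (ι : AlgebraicClosure ℚ →ₐ[ℚ] AlgebraicClosure (v.adicCompletion ℚ)) :
    ∃ x : geomTorsion W p, x ≠ 0 ∧
      ∀ σ : absoluteGaloisGroup (v.adicCompletion ℚ), resGalOfEmb ι σ • x = x := by
  obtain ⟨-, hp2, -, hirr⟩ := hX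
  obtain ⟨e, Φ, he, -⟩ := exists_frame_galoisRepTorsion_rat W p
  have hG : ¬ p ∣ Nat.card (galoisRepTorsion W p).range := by
    rw [← card_map_range_galoisRepTorsion W p Φ]
    exact not_dvd_card_of_not_hasSurjectiveModNGaloisRep W p Φ e he hirr hns
  exact exists_fixed_torsion_of_split_of_not_dvd_card W p hp2 hv hsplit hG ι

end Summit.BirchSwinnertonDyer.BirchSwinnertonDyer.Theorems.CornerLocal

end
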